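import Mathlib
import HarnessLib
import Summits.QuantumFields.YangMills.Theorems.FemtoCurvatureSkewness.Negative.WeakCoupling

/-!
# `FemtoCurvatureSkewness`, line `coupling-cubic-response` — E-internal helper A2 (format bound):
the crux cumulant is uniformly bounded, `|κ₃(L, β, n)| ≤ 24 N³`

Helper toward the ENGINE stub `MarkedCouplingDominance` of crux `stmt-QuantumFields-9365`
(`LangevinControlUV.FemtoCurvatureSkewness`).  The crux's third cumulant
`κ₃ = κ₃(P_0^{01}, P_{ne₂}^{01}, P_{ne₃}^{01})` (`kappa3`) is a fixed polynomial in Wilson expectations of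
products of at most three plaquette variables `0 ≤ P ≤ 2N` (`plaq_nonneg`, `plaq_le`); every such expectation
is a mean against the probability measure `wilsonMeasure`, hence lies in `[0, (2N)^k]`.  Consequently
`|κ₃(L, β, n)| ≤ 3 · (2N)³ = 24 N³` for EVERY torus `L`, coupling `β`, separation `n`, compact `G` and
`LatticeRep r` — the elementary a-priori ("format") bound every engine estimate of the line starts from
(the constant depends on `N = r.N` only).  Tree objects only; no `sorry`.

* `wE_nonneg`, `wE_le_of_le` : `0 ≤ F ≤ M ⇒ 0 ≤ E_β[F] ≤ M`;
* `abs_kappa3_le` / **`Kappa3UniformBound`** (registered sub-goal): `|κ₃(L, β, n)| ≤ 24 N³`.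
-/

noncomputable section

namespace Summit.QuantumFields.YangMills.Theorems.FemtoCurvatureSkewness

open MeasureTheory Filter Topology
open Literature.MathematicalPhysics.QuantumFieldTheory
open Summit.QuantumFields.YangMills.Theorems.ContinuumLimitOnTrajectory.Negative
open Summit.QuantumFields.YangMills.Theorems.FemtoCurvatureSkewness.Negative

section Wilson

variable {G : Type} [Group G] [TopologicalSpace G] [IsTopologicalGroup G] [CompactSpace G]
  [MeasurableSpace G] [BorelSpace G]

/-- A non-negative observable has a non-negative Wilson expectation. -/
theorem wE_nonneg (r : LatticeRep G) (L : ℕ) [NeZero L] (β : ℝ) {F : GaugeConfig 4 L G → ℝ}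
    (h0 : ∀ U, 0 ≤ F U) : 0 ≤ wE r L β F :=
  integral_nonneg h0

/-- An observable with `0 ≤ F ≤ M` has Wilson expectation `≤ M` (the Wilson measure is a probability
measure). -/
theorem wE_le_of_le (r : LatticeRep G) (L : ℕ) [NeZero L] (β : ℝ) {F : GaugeConfig 4 L G → ℝ} {M : ℝ}
    (h0 : ∀ U, 0 ≤ F U) (hM : ∀ U, F U ≤ M) : wE r L β F ≤ M := by
  haveI := isProbabilityMeasure_wilsonMeasure (d := 4) (L := L) r.ρ r.continuous β
  have h := abs_integral_le (wilsonMeasure (d := 4) (L := L) r.ρ β) (f := F) (C := M)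
    (fun U => by rw [abs_of_nonneg (h0 U)]; exact hM U)
  exact (le_abs_self _).trans h

/-- **The crux cumulant is uniformly bounded**: `|κ₃(L, β, n)| ≤ 24 N³` for all `L`, `β`, `n`. -/
theorem abs_kappa3_le (r : LatticeRep G) (L : ℕ) [NeZero L] (β : ℝ) (n : ℕ) :
    |kappa3 r L β n| ≤ 24 * (r.N : ℝ) ^ 3 := by
  set a : ℝ := 2 * r.N with ha
  have ha0 : 0 ≤ a := by positivity
  set y : Site 4 L := Pi.single (2 : Fin 4) ((n : ℕ) : ZMod L) with hy
  set z : Site 4 L := Pi.single (3 : Fin 4) ((n : ℕ) : ZMod L) with hz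
  -- the seven moments entering `κ₃`
  have hP0 : ∀ (x : Site 4 L) (U : GaugeConfig 4 L G), 0 ≤ plaq r L x 0 1 U :=
    fun x U => plaq_nonneg r L x 0 1 U
  have hPa : ∀ (x : Site 4 L) (U : GaugeConfig 4 L G), plaq r L x 0 1 U ≤ a :=
    fun x U => plaq_le r L x 0 1 U
  have hPP0 : ∀ (x x' : Site 4 L) (U : GaugeConfig 4 L G), 0 ≤ plaq r L x 0 1 U * plaq r L x' 0 1 U :=
    fun x x' U => mul_nonneg (hP0 x U) (hP0 x' U)
  have hPPa : ∀ (x x' : Site 4 L) (U : GaugeConfig 4 L G), plaq r L x 0 1 U * plaq r L x' 0 1 U ≤ a * a :=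
    fun x x' U => mul_le_mul (hPa x U) (hPa x' U) (hP0 x' U) ha0
  have hPPP0 : ∀ U : GaugeConfig 4 L G, 0 ≤ plaq r L 0 0 1 U * plaq r L y 0 1 U * plaq r L z 0 1 U :=
    fun U => mul_nonneg (hPP0 0 y U) (hP0 z U)
  have hPPPa : ∀ U : GaugeConfig 4 L G, plaq r L 0 0 1 U * plaq r L y 0 1 U * plaq r L z 0 1 U ≤ a * a * a :=
    fun U => mul_le_mul (hPPa 0 y U) (hPa z U) (hP0 z U) (mul_nonneg ha0 ha0)
  have e1 : ∀ x : Site 4 L, 0 ≤ wE r L β (plaq r L x 0 1) ∧ wE r L β (plaq r L x 0 1) ≤ a :=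
    fun x => ⟨wE_nonneg r L β (hP0 x), wE_le_of_le r L β (hP0 x) (hPa x)⟩
  have e2 : ∀ x x' : Site 4 L, 0 ≤ wE r L β (fun U => plaq r L x 0 1 U * plaq r L x' 0 1 U) ∧
      wE r L β (fun U => plaq r L x 0 1 U * plaq r L x' 0 1 U) ≤ a * a :=
    fun x x' => ⟨wE_nonneg r L β (hPP0 x x'), wE_le_of_le r L β (hPP0 x x') (hPPa x x')⟩
  have e3 : 0 ≤ wE r L β (fun U => plaq r L 0 0 1 U * plaq r L y 0 1 U * plaq r L z 0 1 U) ∧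
      wE r L β (fun U => plaq r L 0 0 1 U * plaq r L y 0 1 U * plaq r L z 0 1 U) ≤ a * a * a :=
    ⟨wE_nonneg r L β hPPP0, wE_le_of_le r L β hPPP0 hPPPa⟩
  -- abstract the polynomial
  have key : ∀ (E0 E1 E2 E01 E02 E12 E012 : ℝ), 0 ≤ E0 → E0 ≤ a → 0 ≤ E1 → E1 ≤ a → 0 ≤ E2 → E2 ≤ a →
      0 ≤ E01 → E01 ≤ a * a → 0 ≤ E02 → E02 ≤ a * a → 0 ≤ E12 → E12 ≤ a * a →
      0 ≤ E012 → E012 ≤ a * a * a →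
      |E012 - E0 * (E12 - E1 * E2) - E1 * (E02 - E0 * E2) - E2 * (E01 - E0 * E1) - E0 * E1 * E2|
        ≤ 3 * (a * a * a) := by
    intro E0 E1 E2 E01 E02 E12 E012 h0 h0a h1 h1a h2 h2a h01 h01a h02 h02a h12 h12a h012 h012a
    have m1 : E0 * E12 ≤ a * (a * a) := mul_le_mul h0a h12a h12 ha0
    have m2 : E1 * E02 ≤ a * (a * a) := mul_le_mul h1a h02a h02 ha0
    have m3 : E2 * E01 ≤ a * (a * a) := mul_le_mul h2a h01a h01 ha0
    have m4 : E0 * E1 * E2 ≤ a * a * a :=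
      mul_le_mul (mul_le_mul h0a h1a h1 ha0) h2a h2 (mul_nonneg ha0 ha0)
    have n1 : 0 ≤ E0 * E12 := mul_nonneg h0 h12
    have n2 : 0 ≤ E1 * E02 := mul_nonneg h1 h02
    have n3 : 0 ≤ E2 * E01 := mul_nonneg h2 h01
    have n4 : 0 ≤ E0 * E1 * E2 := mul_nonneg (mul_nonneg h0 h1) h2
    rw [abs_le]
    constructor <;> nlinarith
  have h := key _ _ _ _ _ _ _ (e1 0).1 (e1 0).2 (e1 y).1 (e1 y).2 (e1 z).1 (e1 z).2
    (e2 0 y).1 (e2 0 y).2 (e2 0 z).1 (e2 0 z).2 (e2 y z).1 (e2 y z).2 e3.1 e3.2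
  have h24 : 3 * (a * a * a) = 24 * (r.N : ℝ) ^ 3 := by rw [ha]; ring
  rw [← h24]
  simpa only [kappa3, wCov, hy, hz] using h

end Wilson

/-- **Registered sub-goal `Kappa3UniformBound`** of crux `stmt-QuantumFields-9365` (E-internal helper A2, format bound,
toward stub `MarkedCouplingDominance`, line `coupling-cubic-response`): for every compact `G`, every `LatticeRep r`,
every torus `L`, coupling `β` and separation `n`, the crux cumulant satisfies `|κ₃(L, β, n)| ≤ 24 N³` — a bound
depending on `N = r.N` only (not on `L`, `β`, `n`). -/
theorem Kappa3UniformBound :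
    ∀ (G : Type) [Group G] [TopologicalSpace G] [IsTopologicalGroup G] [CompactSpace G] [MeasurableSpace G]
      [BorelSpace G] (r : LatticeRep G) (L : ℕ) [NeZero L] (β : ℝ) (n : ℕ),
      |kappa3 r L β n| ≤ 24 * (r.N : ℝ) ^ 3 :=
  fun _ _ _ _ _ _ _ r L _ β n => abs_kappa3_le r L β n

end Summit.QuantumFields.YangMills.Theorems.FemtoCurvatureSkewness

end
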